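import Mathlib
import HarnessLib
import Literature.Analysis.FluidPDE.KNSSSwirlSupNonpos
import Literature.Analysis.FluidPDE.AncientMildWeakStar
import Summits.NavierStokesRegularity.NavierStokesRegularity.Theorems.HalfSpaceWindowDoorCirculationCarryingRigiditySubSwirlSupersolution
import Summits.NavierStokesRegularity.NavierStokesRegularity.Theorems.HalfSpaceWindowDoorCirculationCarryingRigidityEddyTorqueMeasurePlateau
import Summits.NavierStokesRegularity.NavierStokesRegularity.Theorems.HalfSpaceWindowDoorCirculationCarryingRigidityEddyTorqueChainGeometry
import Summits.NavierStokesRegularity.NavierStokesRegularity.Theorems.AxisTwistDoorAveragedConeLiouvilleRadialDrift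
import Summits.NavierStokesRegularity.NavierStokesRegularity.Theorems.HalfSpaceWindowDoorCirculationCarryingRigidityEddyTorqueOneSided

/-!
# Route `HalfSpaceWindowDoor`, crux `CirculationCarryingRigidity` (stmt-NavierStokesRegularity-25311) — the ONE-SIDED
# eddy-torque engine, part 2: KNSS's PLATEAU (5.14) for swirl SUBSOLUTION pairs, WITHOUT Lemma 2.1 and without exceptional sets

Line `eddy_torque` (LEAD ns-hsw-p1 g5).  KNSS (Acta Math. 203 (2009), proof of Thm 5.3, (5.14)) obtain, for a solution `f ≤ M`
of the swirl equation with `sup f = M > 0`, a rescaled copy `≥ M − ε` on the long annular cylinder `{1 ≤ r ≤ 2, |z| ≤ L} × (1,T)`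
from their Lemma 2.1 (stability of the strong maximum principle for SOLUTIONS).  For the swirl SUBSOLUTION pairs of
`…Defs.IsSubSwirl` (one-sided source slaved to `∂ᵣf ≥ 0`) this file proves the same plateau (`exists_rescale_ge`, on
`(1,T)` for a box ending at `T + 1`) from POSITIVITY PROPAGATION for the supersolution `V = M − F ≥ 0` (data: `…SubSwirlSupersolution`):

* `exists_window_const` / `exists_apex_const` / `exists_rescale_ge` — if the plateau failed at `(s₁, y₁)`, the gradient bound
  gives `V ≥ ε/2` on the ball `B(y₁, ρ)` (no exceptional sets); propagate it along g4's chain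
  (`…EddyTorqueChainGeometry.exists_chain`, `…EddyTorqueMeasurePlateau.propagation_from_measure_along_chain`) to the ball
  `B(y₀, ρ/4)` about the near-maximum point during a window ending just after the box end `T+1`, then through ONE final
  cylinder of adaptive size `ρ_f² T₀ < τ' − (T+1)` (g4's remark (i): the rescaled pair lives up to `τ' = T+1+(−t*)/λ²`, which
  may exceed `T+1` by arbitrarily little) to the point `(T+1, y₀)` itself: `V(T+1,y₀) ≥ β_f β₁ β₀^{N+1} ε/2` with `N ≤ N_max`
  uniform — contradicting `V(T+1,y₀) < η` for the near-maximum defect `η` chosen last.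

Seat ns-hsw-p1 g5 (LEAD of 25311, cell pub-ns-dss).  WHAT THIS IS NOT: not a statement about Navier–Stokes regularity (Clay A); a
linear parabolic tool about HYPOTHETICAL blow-up profiles; helper `--supports` 25311.
-/

noncomputable section

-- the summit and its single sub-problem share the name (CONVENTIONS §1), as in every Theorems file
set_option linter.dupNamespace false

namespace Summit.NavierStokesRegularity.NavierStokesRegularity.Theorems.HalfSpaceWindowDoorCirculationCarryingRigiditySubSwirlPlateau

open MeasureTheory Set Function Filter Topology TopologicalSpace InnerProductSpace WithLp Metric
open scoped Laplacian RealInnerProductSpace ContDiff ENNReal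
open Literature.Analysis Literature.Analysis.FluidPDE
open Summit.NavierStokesRegularity.NavierStokesRegularity.Theorems.HalfSpaceWindowDoorCirculationCarryingRigidityDefs
open Summit.NavierStokesRegularity.NavierStokesRegularity.Theorems.HalfSpaceWindowDoorCirculationCarryingRigiditySubSwirl
open Summit.NavierStokesRegularity.NavierStokesRegularity.Theorems.HalfSpaceWindowDoorCirculationCarryingRigiditySubSwirl.IsSubSwirl
open Summit.NavierStokesRegularity.NavierStokesRegularity.Theorems.HalfSpaceWindowDoorCirculationCarryingRigiditySubSwirlSupersolution.IsSubSwirl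
open Summit.NavierStokesRegularity.NavierStokesRegularity.Theorems.HalfSpaceWindowDoorCirculationCarryingRigidityEddyTorqueMeasurePlateau
  (propagation_from_measure_along_chain positivityPropagationAffineC_holds)
open Summit.NavierStokesRegularity.NavierStokesRegularity.Theorems.HalfSpaceWindowDoorCirculationCarryingRigidityEddyTorqueChainGeometry
  (exists_chain)
open Summit.NavierStokesRegularity.NavierStokesRegularity.Theorems.AveragedConeLiouville.RadialDrift
  (norm_horizontal norm_radialDrift_le divergence_radialDrift contDiffOn_radialDrift)
open Summit.NavierStokesRegularity.NavierStokesRegularity.Theorems.HalfSpaceWindowDoorCirculationCarryingRigidityEddyTorqueOneSided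
  (horizontal_eq_smul_eR)

namespace IsSubSwirl

variable {Cf Cu Cg A τ : ℝ} {F : ℝ → (EuclideanSpace ℝ (Fin 3)) → ℝ}
  {V : ℝ → (EuclideanSpace ℝ (Fin 3)) → (EuclideanSpace ℝ (Fin 3))}

/-- **THE CHAIN WINDOW** (steps (b)–(d)): constants `c₁ > 0` and a time quantum `u₀ ∈ (0, 1/2]` depending only on
`C_u, A, ρ, L, T` such that for every swirl subsolution pair on `(−∞, τ')`, `τ' > T+1`, with `F ≤ M`: a ball bound
`M − F(s₁,·) ≥ λ'` on `B(y₁,ρ)` (`s₁ ∈ (1,T)`, `y₁, y₀ ∈ K`) propagates along g4's chain to `M − F ≥ c₁λ'` on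
`B(y₀, ρ/4) × (e − u₀/8, e)` for a window end `e ∈ (T+1, τ')`, `e ≤ T+1+u₀/32`. -/
theorem exists_window_const (Cu A : ℝ) {ρ L : ℝ} (T : ℝ) (hρpos : 0 < ρ) (hρ8 : ρ ≤ 1 / 8) (hL : 1 ≤ L) :
    ∃ c₁ u₀ : ℝ, 0 < c₁ ∧ 0 < u₀ ∧ u₀ ≤ 1 / 2 ∧ ∀ {Cf Cg τ' : ℝ} {F : ℝ → EuclideanSpace ℝ (Fin 3) → ℝ}
      {V : ℝ → EuclideanSpace ℝ (Fin 3) → EuclideanSpace ℝ (Fin 3)}, IsSubSwirl Cf Cu Cg A τ' F V →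
      ∀ {M : ℝ}, (∀ s < τ', ∀ y, F s y ≤ M) → T + 1 < τ' →
      ∀ {s₁ : ℝ}, s₁ ∈ Ioo 1 T → ∀ {y₁ : EuclideanSpace ℝ (Fin 3)}, y₁ ∈ annCylClosed 1 2 L →
      ∀ {y₀ : EuclideanSpace ℝ (Fin 3)}, y₀ ∈ annCylClosed 1 2 L → ∀ {lam' : ℝ}, 0 < lam' →
      (∀ y ∈ ball y₁ ρ, lam' ≤ M - F s₁ y) →
      ∃ e : ℝ, T + 1 < e ∧ e < τ' ∧ e ≤ T + 1 + u₀ / 32 ∧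
        ∀ t ∈ Ioo (e - u₀ / 8) e, ∀ y ∈ ball y₀ (ρ / 4), c₁ * lam' ≤ M - F t y := by
  -- ### constants
  obtain ⟨B₀, hB₀⟩ : ∃ B₀ : ℝ, B₀ = 4 / 3 * (Cu + |2 - A|) := ⟨_, rfl⟩
  obtain ⟨Λ, hΛdef⟩ : ∃ Λ : ℝ, Λ = 4 * |B₀| * ρ := ⟨_, rfl⟩
  have hΛ : 0 ≤ Λ := by rw [hΛdef]; positivity
  have hΛρ : B₀ ≤ Λ / ρ := by rw [hΛdef]; exact driftConst_le_div hρpos (by linarith)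
  have hΛρ2 : B₀ ≤ Λ / (ρ / 2) := by rw [hΛdef]; exact driftConst_le_div (by positivity) (by linarith)
  obtain ⟨nmax, hnmax⟩ : ∃ nmax : ℝ, nmax = (2 * L + 8 * Real.pi + 2) / (ρ / 4) + 1 := ⟨_, rfl⟩
  have hnmax0 : 0 < nmax := by rw [hnmax]; positivity
  obtain ⟨u₀, hu₀def⟩ : ∃ u₀ : ℝ, u₀ = min (1 / 2) (8 / (nmax + 6)) := ⟨_, rfl⟩
  have hu₀pos : 0 < u₀ := by rw [hu₀def]; exact lt_min (by norm_num) (by positivity)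
  have hu₀half : u₀ ≤ 1 / 2 := by rw [hu₀def]; exact min_le_left _ _
  have hu₀n : u₀ * (nmax + 6) ≤ 8 := by
    have h1 : u₀ ≤ 8 / (nmax + 6) := by rw [hu₀def]; exact min_le_right _ _
    rwa [le_div_iff₀ (by positivity)] at h1
  obtain ⟨T₀, hT₀def⟩ : ∃ T₀ : ℝ, T₀ = u₀ / ρ ^ 2 := ⟨_, rfl⟩
  have hT₀ : 0 < T₀ := by rw [hT₀def]; positivity
  have hu : ρ ^ 2 * T₀ = u₀ := by rw [hT₀def]; field_simp
  have e1 : ρ ^ 2 * T₀ / 2 = u₀ / 2 := by rw [← hu]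
  have e2 : (ρ / 2) ^ 2 * T₀ / 2 = u₀ / 8 := by rw [← hu]; ring
  have e3 : (ρ / 2) ^ 2 * T₀ = u₀ / 4 := by rw [← hu]; ring
  have e4 : ρ ^ 2 * T₀ / 3 = u₀ / 3 := by rw [← hu]
  obtain ⟨β₁, β₀, hβ₁, hβ₀, hβ₀1, Hchain⟩ :=
    propagation_from_measure_along_chain (T := T₀) (Λ := Λ) (δ := 4) hT₀ hΛ (by norm_num)
  obtain ⟨Nmax, hNmax⟩ : ∃ Nmax : ℕ, Nmax = ⌈8 * T / u₀⌉₊ + 8 := ⟨_, rfl⟩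
  have hNmax' : 8 * T / u₀ + 8 ≤ (Nmax : ℝ) := by
    rw [hNmax]; push_cast; linarith [Nat.le_ceil (8 * T / u₀)]
  refine ⟨β₁ * β₀ ^ (Nmax + 1), u₀, by positivity, hu₀pos, hu₀half, ?_⟩
  intro Cf Cg τ' F V hP M hFM hτ' s₁ hs₁ y₁ hy₁ y₀ hy₀K lam' hlam' hball
  obtain ⟨hUo, hVC2, hbC1, -⟩ := supersolution_data hP hFM
  have hB₀le : 4 / 3 * (Cu + |2 - A|) ≤ B₀ := hB₀.ge
  -- ### (b) the chain of centres from `y₁` to `y₀`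
  obtain ⟨x, n, hx0, hxn, hnle, hdist, hxK⟩ := exists_chain (L := L) (σ := ρ / 4) (by linarith) (by positivity) hy₁ hy₀K
  rw [← hnmax] at hnle
  -- ### (c) the times
  obtain ⟨g, hgdef⟩ : ∃ g : ℝ, g = min (τ' - (T + 1)) (u₀ / 16) := ⟨_, rfl⟩
  have hgpos : 0 < g := by rw [hgdef]; exact lt_min (by linarith) (by positivity)
  have hgγ : g ≤ τ' - (T + 1) := by rw [hgdef]; exact min_le_left _ _
  have hgu : g ≤ u₀ / 16 := by rw [hgdef]; exact min_le_right _ _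
  obtain ⟨estar, hestar⟩ : ∃ estar : ℝ, estar = T + 1 + g / 2 := ⟨_, rfl⟩
  have hestarτ : estar < τ' := by rw [hestar]; linarith
  obtain ⟨N, hnN', hNle, hDlt, hDge⟩ := exists_steps (D := estar - s₁) (T := T) hu₀pos hnmax0 hu₀n
    (by rw [hestar]; linarith [hs₁.2]) (by rw [hestar]; linarith [hs₁.1])
  have hnN : n ≤ N := by exact_mod_cast hnle.trans hnN'
  have hNmaxle : N ≤ Nmax := by exact_mod_cast hNle.trans hNmax'
  obtain ⟨tI, htIdef⟩ : ∃ tI : ℝ, tI = estar - ((N : ℝ) + 6) * u₀ / 8 := ⟨_, rfl⟩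
  have hend : tI + u₀ / 2 + N * (u₀ / 8) + u₀ / 4 = estar := by rw [htIdef]; ring
  have hs₁tI : tI < s₁ := by rw [htIdef]; linarith
  have hs₁tI' : s₁ ≤ tI + u₀ / 8 := by rw [htIdef]; linarith
  have hx0' : x 0 = y₁ := hx0
  have hxN : x N = y₀ := hxn N hnN
  have hρ4 : ρ ≤ 1 / 4 := by linarith
  have hcyl_time : ∀ k : ℕ, k ≤ N → tI + u₀ / 2 + k * (u₀ / 8) + u₀ / 4 ≤ estar := by
    intro k hk
    have hk' : (k : ℝ) ≤ N := by exact_mod_cast hk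
    have : (k : ℝ) * (u₀ / 8) ≤ N * (u₀ / 8) := mul_le_mul_of_nonneg_right hk' (by positivity)
    linarith [hend]
  -- ### (d) the chain propagation
  have hchain := Hchain (fun s y => M - F s y) (fun s (y : EuclideanSpace ℝ (Fin 3)) => V s y + ((2 - A) / cylRadius y ^ 2) •
      (y 0 • EuclideanSpace.single (0 : Fin 3) (1 : ℝ) + y 1 • EuclideanSpace.single (1 : Fin 3) (1 : ℝ)))
    (Iio τ' ×ˢ {y : EuclideanSpace ℝ (Fin 3) | 1 / 2 < cylRadius y}) x tI ρ lam' s₁ N hρpos hlam' hUo hVC2 hbC1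
    (by
      rw [hx0', hu]
      exact cylinder_subset hy₁.1 hρ4 _ (by linarith [hs₁.2]))
    (by
      intro t ht y hy
      rw [hx0'] at hy
      rw [hu] at ht
      exact pack hP hFM hy₁.1 hρ4 (hB₀le.trans hΛρ) (by linarith [ht.2, hs₁.2]) hy)
    hs₁tI (by rw [e4]; linarith)
    (by rw [hx0']; exact measure_superlevel_ge hρpos hball)
    (fun k _ => by linarith [hdist k])
    (by
      intro k hk
      rw [e1, e2, e3]
      exact cylinder_subset (hxK k).1 (by linarith) _ (by linarith [hcyl_time k hk]))
    (by
      intro k hk t ht y hy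
      rw [e1, e2, e3] at ht
      exact pack hP hFM (hxK k).1 (by linarith) (hB₀le.trans hΛρ2) (by linarith [ht.2, hcyl_time k hk]) hy)
    N le_rfl
  rw [e1, e2, e3, hxN] at hchain
  refine ⟨estar, by rw [hestar]; linarith, hestarτ, by rw [hestar]; linarith, fun t ht y hy => ?_⟩
  have hpow : β₀ ^ (Nmax + 1) ≤ β₀ ^ (N + 1) := pow_le_pow_of_le_one hβ₀.le hβ₀1 (by omega)
  have h1 : β₁ * β₀ ^ (Nmax + 1) * lam' ≤ β₁ * β₀ ^ (N + 1) * lam' :=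
    mul_le_mul_of_nonneg_right (mul_le_mul_of_nonneg_left hpow hβ₁.le) hlam'.le
  have h2 := hchain t ⟨by linarith [ht.1], by linarith [ht.2]⟩ y (by rw [show ρ / 2 / 2 = ρ / 4 by ring]; exact hy)
  exact h1.trans h2

/-- **THE FINAL CYLINDER** (step (e)): for a time quantum `u₀` there is `c₂ > 0` (depending on `C_u, A, ρ, u₀`) such that a
lower bound `M − F ≥ c` on `B(y₀, ρ/4) × (e − u₀/8, e)` with `T+1 < e < τ'`, `e ≤ T+1+u₀/32` gives `M − F(T+1, y₀) ≥ c₂ c`: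
ONE cylinder about `y₀` of adaptive size `ρ_f² T₀ ≤ g/4`, `g = min(τ' − (T+1), u₀/16)`, whose conclusion window contains
`T + 1` (g4's remark (i)). -/
theorem exists_apex_const (Cu A : ℝ) {ρ u₀ : ℝ} (hρpos : 0 < ρ) (hρ8 : ρ ≤ 1 / 8) (hu₀pos : 0 < u₀) (T : ℝ) :
    ∃ c₂ : ℝ, 0 < c₂ ∧ ∀ {Cf Cg τ' : ℝ} {F : ℝ → EuclideanSpace ℝ (Fin 3) → ℝ}
      {V : ℝ → EuclideanSpace ℝ (Fin 3) → EuclideanSpace ℝ (Fin 3)}, IsSubSwirl Cf Cu Cg A τ' F V →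
      ∀ {M : ℝ}, (∀ s < τ', ∀ y, F s y ≤ M) → ∀ {e : ℝ}, T + 1 < e → e < τ' → e ≤ T + 1 + u₀ / 32 →
      ∀ {y₀ : EuclideanSpace ℝ (Fin 3)}, 1 ≤ cylRadius y₀ → ∀ {c : ℝ}, 0 < c →
      (∀ t ∈ Ioo (e - u₀ / 8) e, ∀ y ∈ ball y₀ (ρ / 4), c ≤ M - F t y) → c₂ * c ≤ M - F (T + 1) y₀ := by
  obtain ⟨B₀, hB₀⟩ : ∃ B₀ : ℝ, B₀ = 4 / 3 * (Cu + |2 - A|) := ⟨_, rfl⟩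
  obtain ⟨Λ, hΛdef⟩ : ∃ Λ : ℝ, Λ = 4 * |B₀| * ρ := ⟨_, rfl⟩
  have hΛ : 0 ≤ Λ := by rw [hΛdef]; positivity
  obtain ⟨T₀, hT₀def⟩ : ∃ T₀ : ℝ, T₀ = u₀ / ρ ^ 2 := ⟨_, rfl⟩
  have hT₀ : 0 < T₀ := by rw [hT₀def]; positivity
  obtain ⟨βf, hβf, Hfin⟩ := positivityPropagationAffineC_holds 4 T₀ (1 / 2) Λ (by norm_num) hT₀ (by norm_num)
    (by norm_num) hΛ
  refine ⟨βf, hβf, ?_⟩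
  intro Cf Cg τ' F V hP M hFM e he1 he2 he3 y₀ hy₀ c hc hwin
  obtain ⟨hUo, hVC2, hbC1, -⟩ := supersolution_data hP hFM
  have hB₀le : 4 / 3 * (Cu + |2 - A|) ≤ B₀ := hB₀.ge
  obtain ⟨g, hgdef⟩ : ∃ g : ℝ, g = min (τ' - e) (u₀ / 16) := ⟨_, rfl⟩
  have hgpos : 0 < g := by rw [hgdef]; exact lt_min (by linarith) (by positivity)
  have hgγ : g ≤ τ' - e := by rw [hgdef]; exact min_le_left _ _
  have hgu : g ≤ u₀ / 16 := by rw [hgdef]; exact min_le_right _ _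
  obtain ⟨ρf, hρfdef⟩ : ∃ ρf : ℝ, ρf = min (ρ / 4) (ρ / 2 * Real.sqrt (g / u₀)) := ⟨_, rfl⟩
  have hρfpos : 0 < ρf := by rw [hρfdef]; exact lt_min (by positivity) (by positivity)
  have hρf4 : ρf ≤ ρ / 4 := by rw [hρfdef]; exact min_le_left _ _
  have hΛρf : B₀ ≤ Λ / ρf := by rw [hΛdef]; exact driftConst_le_div hρfpos (by linarith)
  obtain ⟨w, hwdef⟩ : ∃ w : ℝ, w = ρf ^ 2 * T₀ := ⟨_, rfl⟩
  have hwpos : 0 < w := by rw [hwdef]; positivity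
  have hwg : w ≤ g / 4 := by
    have h1 : ρf ≤ ρ / 2 * Real.sqrt (g / u₀) := by rw [hρfdef]; exact min_le_right _ _
    have h2 : ρf ^ 2 ≤ (ρ / 2 * Real.sqrt (g / u₀)) ^ 2 := pow_le_pow_left₀ hρfpos.le h1 2
    rw [mul_pow, Real.sq_sqrt (by positivity)] at h2
    calc w = ρf ^ 2 * T₀ := hwdef
      _ ≤ (ρ / 2) ^ 2 * (g / u₀) * T₀ := mul_le_mul_of_nonneg_right h2 hT₀.le
      _ = g / 4 := by rw [hT₀def]; field_simp; ring
  obtain ⟨tI', htI'⟩ : ∃ tI' : ℝ, tI' = T + 1 - 3 * w / 4 := ⟨_, rfl⟩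
  have hdataf : ∀ t ∈ Ioo tI' (tI' + ρf ^ 2 * T₀), ∀ y ∈ ball y₀ ρf,
      ‖V t y + ((2 - A) / cylRadius y ^ 2) •
          (y 0 • EuclideanSpace.single (0 : Fin 3) (1 : ℝ) + y 1 • EuclideanSpace.single (1 : Fin 3) (1 : ℝ))‖ ≤ Λ / ρf ∧
      VectorCalculus.divergence (fun y : EuclideanSpace ℝ (Fin 3) => V t y + ((2 - A) / cylRadius y ^ 2) •
          (y 0 • EuclideanSpace.single (0 : Fin 3) (1 : ℝ) + y 1 • EuclideanSpace.single (1 : Fin 3) (1 : ℝ))) y = 0 ∧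
      0 ≤ M - F t y ∧
      0 ≤ deriv (fun σ => M - F σ y) t - (Δ (fun y' => M - F t y')) y +
        ⟪V t y + ((2 - A) / cylRadius y ^ 2) •
            (y 0 • EuclideanSpace.single (0 : Fin 3) (1 : ℝ) + y 1 • EuclideanSpace.single (1 : Fin 3) (1 : ℝ)),
          gradient (fun y' => M - F t y') y⟫_ℝ := by
    intro t ht y hy
    rw [← hwdef, htI'] at ht
    exact pack hP hFM hy₀ (by linarith) (hB₀le.trans hΛρf) (by linarith [ht.2]) hy
  have hfin := Hfin (fun s y => M - F s y) (fun s (y : EuclideanSpace ℝ (Fin 3)) => V s y + ((2 - A) / cylRadius y ^ 2) •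
      (y 0 • EuclideanSpace.single (0 : Fin 3) (1 : ℝ) + y 1 • EuclideanSpace.single (1 : Fin 3) (1 : ℝ)))
    (Iio τ' ×ˢ {y : EuclideanSpace ℝ (Fin 3) | 1 / 2 < cylRadius y}) y₀ tI' ρf hρfpos hUo
    (cylinder_subset hy₀ (by linarith) _ (by rw [htI', ← hwdef]; linarith))
    hVC2 hbC1 (fun t ht y hy => (hdataf t ht y hy).1) (fun t ht y hy => (hdataf t ht y hy).2.1)
    (fun t ht y hy => (hdataf t ht y hy).2.2.1) (fun t ht y hy => (hdataf t ht y hy).2.2.2)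
    (T + 1 - w / 2) c (by rw [htI']; linarith) (by rw [htI', ← hwdef]; linarith) hc
    (by
      refine measure_superlevel_ge hρfpos fun y hy => hwin _ ⟨?_, ?_⟩ y (ball_subset_ball hρf4 hy)
      · linarith
      · linarith)
    (T + 1) (by rw [htI', ← hwdef]; constructor <;> linarith) y₀ (mem_ball_self (by positivity))
  exact hfin

variable {f : ℝ → (EuclideanSpace ℝ (Fin 3)) → ℝ} {u : ℝ → (EuclideanSpace ℝ (Fin 3)) → (EuclideanSpace ℝ (Fin 3))}

/-- **THE PLATEAU FOR SWIRL SUBSOLUTION PAIRS** (KNSS (5.14) without Lemma 2.1): for a swirl subsolution pair on `(−∞, 0)` whose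
scalar has supremum `M > 0`, approached with near-maxima off the axis, and for `L ≥ 1`, `T ≥ 1`, `ε > 0`, there are `λ > 0`,
`t* < 0`, `z̄` such that the rescaled scalar `f(t* + λ²(s − T − 1), z̄e_z + λy)` (box END `T + 1`, near-maximum there) is
`≥ M − ε` for `s ∈ (1, T)`, `1 ≤ r(y) ≤ 2`, `|y₂| ≤ L`.  Proof: if it failed at `(s₁,y₁)`, the gradient bound gives
`M − F ≥ ε/2` on `B(y₁, ρ)`, and `exists_apex_const` gives `M − F(T+1, y₀) ≥ c ε/2 > η`, against the choice of the near-maximum. -/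
theorem exists_rescale_ge (h : IsSubSwirl Cf Cu Cg A 0 f u) {M : ℝ} (hM : 0 < M) (hfM : ∀ t < 0, ∀ x, f t x ≤ M)
    (happr : ∀ η > 0, ∃ t < 0, ∃ x, M - η < f t x ∧ (η ≤ M → cylRadius x ≠ 0))
    {L T ε : ℝ} (hL : 1 ≤ L) (hε : 0 < ε) :
    ∃ lam > 0, ∃ tstar < (0 : ℝ), ∃ zbar : ℝ,
      ∀ s ∈ Ioo 1 T, ∀ y ∈ annCylClosed 1 2 L,
        M - ε ≤ stPull (lam ^ 2) lam (tstar - lam ^ 2 * (T + 1)) (zbar • eZ) f s y := by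
  have hCg := Cg_nonneg h
  -- ### constants (chosen before the near-maximum point)
  obtain ⟨ρ, hρdef⟩ : ∃ ρ : ℝ, ρ = min (1 / 8) (ε / (8 * Cg + 8)) := ⟨_, rfl⟩
  have hρpos : 0 < ρ := by rw [hρdef]; exact lt_min (by norm_num) (by positivity)
  have hρ8 : ρ ≤ 1 / 8 := by rw [hρdef]; exact min_le_left _ _
  have hρε : 4 * Cg * ρ ≤ ε / 2 := by
    have h1 : ρ ≤ ε / (8 * Cg + 8) := by rw [hρdef]; exact min_le_right _ _
    rw [le_div_iff₀ (by positivity)] at h1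
    nlinarith
  obtain ⟨c₁, u₀, hc₁, hu₀pos, -, Hwin⟩ := exists_window_const Cu A (L := L) T hρpos hρ8 hL
  obtain ⟨c₂, hc₂, Hapex⟩ := exists_apex_const Cu A hρpos hρ8 hu₀pos T
  obtain ⟨η₀, hη₀⟩ : ∃ η₀ : ℝ, η₀ = c₂ * (c₁ * (ε / 2)) := ⟨_, rfl⟩
  have hη₀pos : 0 < η₀ := by rw [hη₀]; positivity
  -- ### the near-maximum point and the rescaling
  obtain ⟨tstar, htstar, xstar, hnear, hoff⟩ := happr (min η₀ (M / 2)) (lt_min hη₀pos (by positivity))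
  have hr : cylRadius xstar ≠ 0 := hoff ((min_le_right _ _).trans (by linarith))
  have hrpos : 0 < cylRadius xstar := lt_of_le_of_ne (cylRadius_nonneg _) (Ne.symm hr)
  obtain ⟨lam, hlam⟩ : ∃ lam : ℝ, lam = cylRadius xstar / (3 / 2) := ⟨_, rfl⟩
  have hlampos : 0 < lam := by rw [hlam]; positivity
  obtain ⟨zbar, hzbar⟩ : ∃ zbar : ℝ, zbar = xstar 2 := ⟨_, rfl⟩
  refine ⟨lam, hlampos, tstar, htstar, zbar, ?_⟩
  have hresc := rescale h hlampos tstar zbar (T + 1)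
  obtain ⟨τ', hτ'⟩ : ∃ τ' : ℝ, τ' = T + 1 + (0 - tstar) / lam ^ 2 := ⟨_, rfl⟩
  rw [← hτ'] at hresc
  set F := stPull (lam ^ 2) lam (tstar - lam ^ 2 * (T + 1)) (zbar • eZ) f with hF
  have hτ'T : T + 1 < τ' := by
    have : 0 < (0 - tstar) / lam ^ 2 := div_pos (by linarith) (by positivity)
    rw [hτ']; linarith
  have hFM : ∀ s < τ', ∀ y, F s y ≤ M := by
    intro s hs y
    rw [hF, stPull_rescale_apply]
    rw [hτ'] at hs
    exact hfM _ ((time_lt_iff hlampos).2 hs) _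
  -- the point `y₀` above which the near-maximum sits
  obtain ⟨y₀, hy₀⟩ : ∃ y₀ : EuclideanSpace ℝ (Fin 3), y₀ = lam⁻¹ • (xstar - zbar • eZ) := ⟨_, rfl⟩
  have hy₀eq : zbar • eZ + lam • y₀ = xstar := by
    rw [hy₀, smul_smul, mul_inv_cancel₀ hlampos.ne', one_smul, add_sub_cancel]
  have hy₀r : cylRadius y₀ = 3 / 2 := by
    have h1 : cylRadius (zbar • eZ + lam • y₀) = lam * cylRadius y₀ := by
      rw [cylRadius_smul_eZ_add_smul, abs_of_pos hlampos]
    rw [hy₀eq] at h1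
    have h2 : cylRadius xstar = lam * (3 / 2) := by rw [hlam]; ring
    exact mul_left_cancel₀ hlampos.ne' (by rw [← h1, ← h2])
  have hy₀z : y₀ 2 = 0 := by simp [hy₀, hzbar, eZ]
  have hy₀K : y₀ ∈ annCylClosed 1 2 L := by
    refine ⟨by rw [hy₀r]; norm_num, by rw [hy₀r]; norm_num, ?_⟩
    rw [hy₀z, abs_zero]; linarith
  have hnear' : M - F (T + 1) y₀ < η₀ := by
    rw [hF, stPull_rescale_apply_T, hy₀eq]
    have := min_le_left η₀ (M / 2)
    linarith
  -- ### the plateau, by contradiction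
  intro s₁ hs₁ y₁ hy₁
  by_contra hlt
  push Not at hlt
  have hs₁τ : s₁ ≤ τ' - 1 := by linarith [hs₁.2]
  have hball : ∀ y ∈ ball y₁ ρ, ε / 2 ≤ M - F s₁ y := by
    intro y hy
    have h1 := abs_sub_le_of_mem_ball hresc hs₁τ hy₁.2.1 (by linarith) hy
    have h2 : ‖y - y₁‖ ≤ ρ := by rw [← dist_eq_norm]; exact (mem_ball.1 hy).le
    have h3 : F s₁ y - F s₁ y₁ ≤ 4 * Cg * ρ :=
      calc F s₁ y - F s₁ y₁ ≤ |F s₁ y - F s₁ y₁| := le_abs_self _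
        _ ≤ 4 * Cg * ‖y - y₁‖ := h1
        _ ≤ 4 * Cg * ρ := mul_le_mul_of_nonneg_left h2 (by positivity)
    linarith only [hlt, h3, hρε]
  obtain ⟨e, he1, he2, he3, hwin⟩ := Hwin hresc hFM hτ'T hs₁ hy₁ hy₀K (by positivity : (0:ℝ) < ε / 2) hball
  have key := Hapex hresc hFM he1 he2 he3 hy₀K.1 (by positivity : (0:ℝ) < c₁ * (ε / 2)) hwin
  rw [← hη₀] at key
  linarith [key, hnear']

end IsSubSwirl

end Summit.NavierStokesRegularity.NavierStokesRegularity.Theorems.HalfSpaceWindowDoorCirculationCarryingRigiditySubSwirlPlateau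

end
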